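import Literature.Topology.FourManifolds.SignatureProductCircle
import Literature.AlgebraicTopology.SingularHomology.TopologicalGroupOrientation
import HarnessLib

/-!
# The oriented `4`-torus: `σ(T⁴) = 0` and `σ(T⁴ # ℂℙ²bar) = -1`

A. Akhmedov, B. D. Park, *Exotic smooth structures on small 4-manifolds with odd signatures*,
Invent. Math. 181 (2010), §4 (arXiv:math/0701829, "Torus surgeries on `T⁴ # ℂℙ²bar`"): "we note
that `e(Z') = e(Z''(1/q, m/r)) = 1` and `σ(Z') = σ(Z''(1/q, m/r)) = -1`", `Z'`, `Z''` being
obtained from the oriented connected sum `T⁴ # ℂℙ²bar` by torus surgeries (which preserve `e` and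
`σ`), i.e. `σ(T⁴ # ℂℙ²bar) = σ(T⁴) + σ(ℂℙ²bar) = 0 + (-1) = -1`.

`Literature.Topology.FourManifolds.SignatureProductCircle` proved `σ(T⁴, μ) = 0` for EVERY
`ℤ`-orientation `μ` of the `4`-torus and the blow-up bookkeeping `σ(T⁴ # ℂℙ²bar, ·) = σ(T⁴, μ) - 1`
with the orientation `μ` as an input.  Here the input is supplied: `T⁴ = (S¹)⁴` (recharted on
`ℝ⁴`) is a Hausdorff topological group charted on `ℝ⁴`, hence `ℤ`-orientable
(`isOrientableOver_int_of_isTopologicalGroup`, `…TopologicalGroupOrientation`; Hatcher 2002 §3.3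
p. 234, Lee 2013 Prop. 15.19 / Example 15.18), so that:

* `exists_fourTorus_oriented_model` — a closed connected smooth `4`-manifold `X ≃ₜ (S¹)³ × S¹`
  (charted on `ℝ⁴`, `C^∞`) which IS `ℤ`-orientable and all of whose `ℤ`-orientations have
  signature `0`;
* `exists_prodCircle_oriented_model` — the same for `N × S¹`, `N` any closed connected smooth `3`-manifold
  which is a topological group;
* `exists_oriented_isConnectedSum_prodCircle_complexProjectivePlane` — the same blow-up statement for
  `N × S¹`, `N` a topological group;
* `exists_oriented_isConnectedSum_fourTorus_complexProjectivePlane` — **an oriented closed smooth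
  `4`-manifold `T⁴ # ℂℙ²bar` of signature `-1`**: an orientation `μ` of `X` (`σ(X, μ) = 0`) and a
  connected sum `P` of `X` with `ℂℙ²` carrying an orientation of signature `-1`, with
  `b₂(P) = b₂(X) + 1` (`exists_isConnectedSum_complexProjectivePlane_signature_sub_one`).

The torus-surgery invariance of `σ` (passage from `T⁴ # ℂℙ²bar` to `Z'`, `Z''`) is NOT formalised
here.  Everything is proved; no definitions, no named facts.

## References

* A. Akhmedov, B. D. Park, Invent. Math. 181 (2010) 577–603, §4. [AkhmedovPark2010]
* A. Hatcher, *Algebraic Topology*, CUP 2002, §3.3 p. 234. [HatcherAT2002]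
* J. M. Lee, *Introduction to Smooth Manifolds*, 2nd ed., Springer 2013, Prop. 15.19,
  Example 15.18. [LeeSmoothManifolds2013]
* R. E. Gompf, A. I. Stipsicz, *4-Manifolds and Kirby Calculus*, AMS 1999, §1.2. [GompfStipsiczGSM1999]
-/

noncomputable section

open Set Function
open scoped Manifold ContDiff Topology
open Literature.AlgebraicTopology.SingularHomology
open Literature.Geometry.Manifold (Rechart)

namespace Literature.Topology.FourManifolds

/-- **The oriented `4`-torus.** There is a closed connected smooth `4`-manifold `X` in `Type`,
charted on `ℝ⁴` and `C^∞` for `𝓡 4`, homeomorphic to `(S¹ × S¹ × S¹) × S¹` (Mathlib's `Circle`;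
the product Lie group recharted twice along linear isomorphisms `ℝ¹ × (ℝ¹ × ℝ¹) ≃L ℝ³`,
`ℝ³ × ℝ¹ ≃L ℝ⁴`, `Literature.Geometry.Manifold.Rechart`), which is `ℤ`-ORIENTABLE — it is a
Hausdorff topological group charted on `ℝ⁴` (`isOrientableOver_int_of_isTopologicalGroup`;
Lee 2013, Example 15.18: the tori are orientable) — and all of whose `ℤ`-orientations have
signature `0` (`signature_prodCircle_eq_zero`: the reflection in the last circle factor reverses
the orientation; Kirby 1989, II §5 p. 27).
[cite: LeeSmoothManifolds2013, Example 15.18] [cite: Kirby1989, Ch. II §5 p. 27] -/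
theorem exists_fourTorus_oriented_model :
    ∃ (X : Type) (_ : TopologicalSpace X) (_ : T2Space X) (_ : SecondCountableTopology X)
      (_ : ChartedSpace (EuclideanSpace ℝ (Fin 4)) X) (_ : IsManifold (𝓡 4) ∞ X)
      (_ : CompactSpace X) (_ : ConnectedSpace X),
      Nonempty (X ≃ₜ (Circle × Circle × Circle) × Circle) ∧ IsOrientableOver ℤ X 4 ∧
        ∀ μ : HomologicalOrientation ℤ X 4, μ.signature = 0 := by
  -- the `3`-torus recharted on `ℝ³`
  let L₃ : (EuclideanSpace ℝ (Fin 1) × (EuclideanSpace ℝ (Fin 1) × EuclideanSpace ℝ (Fin 1))) ≃L[ℝ]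
      EuclideanSpace ℝ (Fin 3) := ContinuousLinearEquiv.ofFinrankEq (by simp)
  let f₃ : ModelProd (EuclideanSpace ℝ (Fin 1)) (ModelProd (EuclideanSpace ℝ (Fin 1))
      (EuclideanSpace ℝ (Fin 1))) ≃ₜ EuclideanSpace ℝ (Fin 3) := L₃.toHomeomorph
  have hIf₃ : ∀ x, f₃ x = L₃ (((𝓡 1).prod ((𝓡 1).prod (𝓡 1))) x) := fun x => rfl
  have hf₃ := Rechart.contMDiff_of_apply_eq_linear (I := (𝓡 1).prod ((𝓡 1).prod (𝓡 1))) (n := ∞)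
    f₃ L₃ hIf₃
  have hf₃' := Rechart.contMDiff_symm_of_apply_eq_linear (I := (𝓡 1).prod ((𝓡 1).prod (𝓡 1)))
    (n := ∞) f₃ L₃ hIf₃
  haveI hN : IsManifold (𝓡 3) ∞ (Rechart f₃ (Circle × Circle × Circle)) :=
    Rechart.isManifold f₃ _ hf₃ hf₃'
  haveI : ConnectedSpace (Rechart f₃ (Circle × Circle × Circle)) :=
    inferInstanceAs (ConnectedSpace (Circle × Circle × Circle))
  -- `X = T³ × S¹` recharted on `ℝ⁴`
  let L₄ : (EuclideanSpace ℝ (Fin 3) × EuclideanSpace ℝ (Fin 1)) ≃L[ℝ] EuclideanSpace ℝ (Fin 4) :=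
    ContinuousLinearEquiv.ofFinrankEq (by simp)
  let f₄ : ModelProd (EuclideanSpace ℝ (Fin 3)) (EuclideanSpace ℝ (Fin 1)) ≃ₜ
      EuclideanSpace ℝ (Fin 4) := L₄.toHomeomorph
  have hIf₄ : ∀ x, f₄ x = L₄ (((𝓡 3).prod (𝓡 1)) x) := fun x => rfl
  have hf₄ := Rechart.contMDiff_of_apply_eq_linear (I := (𝓡 3).prod (𝓡 1)) (n := ∞) f₄ L₄ hIf₄
  have hf₄' := Rechart.contMDiff_symm_of_apply_eq_linear (I := (𝓡 3).prod (𝓡 1)) (n := ∞) f₄ L₄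
    hIf₄
  have hXm : IsManifold (𝓡 4) ∞ (Rechart f₄ (Rechart f₃ (Circle × Circle × Circle) × Circle)) :=
    Rechart.isManifold f₄ _ hf₄ hf₄'
  haveI : SecondCountableTopology (Rechart f₄ (Rechart f₃ (Circle × Circle × Circle) × Circle)) :=
    inferInstanceAs (SecondCountableTopology ((Circle × Circle × Circle) × Circle))
  haveI : ConnectedSpace (Rechart f₄ (Rechart f₃ (Circle × Circle × Circle) × Circle)) :=
    inferInstanceAs (ConnectedSpace ((Circle × Circle × Circle) × Circle))
  -- as a topological space `X` is the topological group `(S¹)³ × S¹`, charted on `ℝ⁴` by the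
  -- recharted atlas: `ℤ`-orientable
  have hO' := @isOrientableOver_int_of_isTopologicalGroup 4 ((Circle × Circle × Circle) × Circle)
    _ _ _ _ (Rechart.instChartedSpace f₄ (Rechart f₃ (Circle × Circle × Circle) × Circle))
  have hO : IsOrientableOver ℤ (Rechart f₄ (Rechart f₃ (Circle × Circle × Circle) × Circle)) 4 :=
    hO'
  refine ⟨Rechart f₄ (Rechart f₃ (Circle × Circle × Circle) × Circle), inferInstance, inferInstance,
    inferInstance, inferInstance, hXm, inferInstance, inferInstance,
    ⟨(Rechart.outHomeomorph f₄ _).trans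
      ((Rechart.outHomeomorph f₃ _).prodCongr (Homeomorph.refl Circle))⟩, hO, fun μ => ?_⟩
  exact signature_prodCircle_eq_zero f₄ L₄ (fun _ => rfl) μ

/-- **`N³ × S¹` for a topological group `N`: oriented, signature zero.** For a closed connected
smooth `3`-manifold `N` which is a topological group (e.g. `T³`, `S³ = SU(2)`, `SO(3)`), the closed
smooth `4`-manifold `X ≃ₜ N × S¹` of `exists_prodCircle_model` is `ℤ`-ORIENTABLE — as a
topological space it is the topological group `N × S¹`, charted on `ℝ⁴`
(`isOrientableOver_int_of_isTopologicalGroup`; Lee 2013, Prop. 15.19) — and all of its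
`ℤ`-orientations have signature `0` (`signature_prodCircle_eq_zero`; Kirby 1989, II §5 p. 27).
[cite: LeeSmoothManifolds2013, Prop. 15.19] [cite: Kirby1989, Ch. II §5 p. 27] -/
theorem exists_prodCircle_oriented_model (N : Type) [TopologicalSpace N] [Group N]
    [IsTopologicalGroup N] [T2Space N] [SecondCountableTopology N] [CompactSpace N]
    [ConnectedSpace N] [ChartedSpace (EuclideanSpace ℝ (Fin 3)) N] [IsManifold (𝓡 3) ∞ N] :
    ∃ (X : Type) (_ : TopologicalSpace X) (_ : T2Space X) (_ : SecondCountableTopology X)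
      (_ : ChartedSpace (EuclideanSpace ℝ (Fin 4)) X) (_ : IsManifold (𝓡 4) ∞ X)
      (_ : CompactSpace X) (_ : ConnectedSpace X),
      Nonempty (X ≃ₜ N × Circle) ∧ IsOrientableOver ℤ X 4 ∧
        ∀ μ : HomologicalOrientation ℤ X 4, μ.signature = 0 := by
  let L : (EuclideanSpace ℝ (Fin 3) × EuclideanSpace ℝ (Fin 1)) ≃L[ℝ] EuclideanSpace ℝ (Fin 4) :=
    ContinuousLinearEquiv.ofFinrankEq (by simp)
  let f : ModelProd (EuclideanSpace ℝ (Fin 3)) (EuclideanSpace ℝ (Fin 1)) ≃ₜ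
      EuclideanSpace ℝ (Fin 4) := L.toHomeomorph
  have hIf : ∀ x, f x = L (((𝓡 3).prod (𝓡 1)) x) := fun x => rfl
  have hf := Rechart.contMDiff_of_apply_eq_linear (I := (𝓡 3).prod (𝓡 1)) (n := ∞) f L hIf
  have hf' := Rechart.contMDiff_symm_of_apply_eq_linear (I := (𝓡 3).prod (𝓡 1)) (n := ∞) f L hIf
  have hX : IsManifold (𝓡 4) ∞ (Rechart f (N × Circle)) := Rechart.isManifold f _ hf hf'
  haveI : SecondCountableTopology (Rechart f (N × Circle)) :=
    inferInstanceAs (SecondCountableTopology (N × Circle))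
  haveI : ConnectedSpace (Rechart f (N × Circle)) := inferInstanceAs (ConnectedSpace (N × Circle))
  have hO' := @isOrientableOver_int_of_isTopologicalGroup 4 (N × Circle) _ _ _ _
    (Rechart.instChartedSpace f (N × Circle))
  have hO : IsOrientableOver ℤ (Rechart f (N × Circle)) 4 := hO'
  exact ⟨Rechart f (N × Circle), inferInstance, inferInstance, inferInstance, inferInstance, hX,
    inferInstance, inferInstance, ⟨Rechart.outHomeomorph f _⟩, hO,
    fun μ => signature_prodCircle_eq_zero f L (fun _ => rfl) μ⟩

/-- **An oriented `T⁴ # ℂℙ²bar` has signature `-1`** (Akhmedov–Park 2010, §4: "`σ(Z') =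
σ(Z''(1/q, m/r)) = -1`" for the torus-surgered `T⁴ # ℂℙ²bar`; Gompf–Stipsicz 1999, §1.2:
`σ(M # N) = σ(M) + σ(N)`, `σ(ℂℙ²bar) = -1`). For the `4`-torus `X ≃ₜ (S¹)³ × S¹` of
`exists_fourTorus_oriented_model` there EXIST a `ℤ`-orientation `μ` of `X` (with `σ(X, μ) = 0`)
and a closed connected smooth `4`-manifold `P`, a connected sum of `X` with `ℂℙ²`, carrying a
`ℤ`-orientation of signature `-1`, with `b₂(P) = b₂(X) + 1`
(`exists_isConnectedSum_complexProjectivePlane_signature_sub_one` applied to the orientation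
supplied by `isOrientableOver_int_of_isTopologicalGroup`). The torus-surgery invariance of `σ` is
NOT formalised. [cite: AkhmedovPark2010, §4 ("σ(Z') = σ(Z''(1/q,m/r)) = -1")] [cite: GompfStipsiczGSM1999, §1.2] -/
theorem exists_oriented_isConnectedSum_fourTorus_complexProjectivePlane :
    ∃ (X : Type) (_ : TopologicalSpace X) (_ : T2Space X) (_ : SecondCountableTopology X)
      (_ : ChartedSpace (EuclideanSpace ℝ (Fin 4)) X) (_ : IsManifold (𝓡 4) ∞ X)
      (_ : CompactSpace X) (_ : ConnectedSpace X),
      Nonempty (X ≃ₜ (Circle × Circle × Circle) × Circle) ∧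
        ∃ (μ : HomologicalOrientation ℤ X 4) (P : Type) (_ : TopologicalSpace P) (_ : T2Space P)
          (_ : SecondCountableTopology P) (_ : ChartedSpace (EuclideanSpace ℝ (Fin 4)) P)
          (_ : IsManifold (𝓡 4) ∞ P) (_ : CompactSpace P) (_ : ConnectedSpace P)
          (μP : HomologicalOrientation ℤ P 4),
          μ.signature = 0 ∧ IsConnectedSum (𝓡 4) (𝓡 4) (𝓡 4) X ComplexProjectivePlane P ∧
            μP.signature = -1 ∧
              Module.finrank ℤ (freeCohomology ℤ P 2) =
                Module.finrank ℤ (freeCohomology ℤ X 2) + 1 := by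
  obtain ⟨X, _, _, _, _, _, _, _, hXe, ⟨μ⟩, hσ⟩ := exists_fourTorus_oriented_model
  obtain ⟨P, _, _, _, _, _, _, _, μP, hsum, hσP, hb⟩ :=
    exists_isConnectedSum_complexProjectivePlane_signature_sub_one X μ
  exact ⟨X, inferInstance, inferInstance, inferInstance, inferInstance, inferInstance, inferInstance,
    inferInstance, hXe, μ, P, inferInstance, inferInstance, inferInstance, inferInstance,
    inferInstance, inferInstance, inferInstance, μP, hσ μ, hsum, by rw [hσP, hσ μ]; norm_num, hb⟩

/-- **An oriented `(N³ × S¹) # ℂℙ²bar` of signature `-1`, `N` a topological group** (the case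
`N = T³` is Akhmedov–Park's `σ(T⁴ # ℂℙ²bar) = 0 + (-1) = -1`, §4): for a closed connected smooth
`3`-manifold `N` which is a topological group there are a closed smooth `X ≃ₜ N × S¹`, a
`ℤ`-orientation `μ` of `X` (`σ(X, μ) = 0`) and a connected sum `P` of `X` with `ℂℙ²` carrying an
orientation of signature `-1`, `b₂(P) = b₂(X) + 1` (`exists_prodCircle_oriented_model` +
`exists_isConnectedSum_complexProjectivePlane_signature_sub_one`).
[cite: AkhmedovPark2010, §4 ("σ(Z') = σ(Z''(1/q,m/r)) = -1")] [cite: GompfStipsiczGSM1999, §1.2] -/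
theorem exists_oriented_isConnectedSum_prodCircle_complexProjectivePlane (N : Type)
    [TopologicalSpace N] [Group N] [IsTopologicalGroup N] [T2Space N] [SecondCountableTopology N]
    [CompactSpace N] [ConnectedSpace N] [ChartedSpace (EuclideanSpace ℝ (Fin 3)) N]
    [IsManifold (𝓡 3) ∞ N] :
    ∃ (X : Type) (_ : TopologicalSpace X) (_ : T2Space X) (_ : SecondCountableTopology X)
      (_ : ChartedSpace (EuclideanSpace ℝ (Fin 4)) X) (_ : IsManifold (𝓡 4) ∞ X)
      (_ : CompactSpace X) (_ : ConnectedSpace X),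
      Nonempty (X ≃ₜ N × Circle) ∧
        ∃ (μ : HomologicalOrientation ℤ X 4) (P : Type) (_ : TopologicalSpace P) (_ : T2Space P)
          (_ : SecondCountableTopology P) (_ : ChartedSpace (EuclideanSpace ℝ (Fin 4)) P)
          (_ : IsManifold (𝓡 4) ∞ P) (_ : CompactSpace P) (_ : ConnectedSpace P)
          (μP : HomologicalOrientation ℤ P 4),
          μ.signature = 0 ∧ IsConnectedSum (𝓡 4) (𝓡 4) (𝓡 4) X ComplexProjectivePlane P ∧
            μP.signature = -1 ∧
              Module.finrank ℤ (freeCohomology ℤ P 2) =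
                Module.finrank ℤ (freeCohomology ℤ X 2) + 1 := by
  obtain ⟨X, _, _, _, _, _, _, _, hXe, ⟨μ⟩, hσ⟩ := exists_prodCircle_oriented_model N
  obtain ⟨P, _, _, _, _, _, _, _, μP, hsum, hσP, hb⟩ :=
    exists_isConnectedSum_complexProjectivePlane_signature_sub_one X μ
  exact ⟨X, inferInstance, inferInstance, inferInstance, inferInstance, inferInstance, inferInstance,
    inferInstance, hXe, μ, P, inferInstance, inferInstance, inferInstance, inferInstance,
    inferInstance, inferInstance, inferInstance, μP, hσ μ, hsum, by rw [hσP, hσ μ]; norm_num, hb⟩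

end Literature.Topology.FourManifolds

end
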